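import Summits.QuantumFields.BalabanUV.Beta.D1BFx.ScaleLegRows
import Literature.MathematicalPhysics.QuantumFieldTheory.Balaban1983to89.Beta.WindowIdentification

/-!
# `BalabanUV.Beta.D1BFx.ScaleLegTermCount` — road «BF-x» for binder row D1, «A3.c ∕ L-X TAILS» part (C1): THE WINDOW + TAIL COUNT on `ℤ⁴`
# (window `C₁/((r+1)³n) + C₂/(r+1)⁵`, tail `E e^{−(δ/n)(r+1)}/(r+1)⁴` ⇒ `|fullSum| ≤ 80C₁ + 160C₂ + 80E(1+1/δ)`, n-FREE) and the abstract
# per-point TAIL ∕ WINDOW forms of a weighted located product `P(w)·c·H₁(x−w)·H₂(w+y)`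

HONEST DEPENDENCY (page 1, mandatory): continuum YM on T⁴ ⇐ BetaPertH ∧ nine spine estimates (0/9 proved); BetaPertH ⇐ (D1) ∧ (D4) ∧
CAP+tail; G-an2-4 gates asym, D1 and NE2/3/4.  HONEST FRAMING (cell contract, verbatim): «discharging `BetaPertH` makes Bałaban's UV
stability UNCONDITIONAL — a real constructive-QFT result; it is NOT the continuum limit and NOT the Clay problem.»  THIS MODULE DISCHARGES
NOTHING of the wall: [folklore] shell counting and real inequalities about ARBITRARY functions `P, H₁, H₂, F_i, Φ_i : ℤ⁴ → ℝ`, composed BY NAME from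
`WindowIdentification` (`fullSum`, `psum`, `abs_fullSum_sub_psum_le`, `exists_tendsto_psum_of_shellBound`), `TransferUV` (`card_annulus_succ_four_le`,
`sum_inv_pow_le_two`), `WindowLog.shellSum`, part (B) `ScaleLegRows` (soft transport).  Nothing about Bałaban's kernels is asserted; no `def`, no `Prop`
minted, nothing cited, 0 sorry.  0 wall binders; NOT the L-X row, NOT A3.c, NOT (K), NOT D1, NOT `BetaPertH`, NOT continuum, NOT Clay.

ABSOLUTE RULE (cell charter, verbatim): «No internally-minted statement may enter as a cited fact. Every hypothesis is either kernel-proved in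
this package or a verbatim quotation of a PUBLISHED theorem with page reference. The manuscript(s) under audit are NOT citable for their own
disputed steps — they are the thing under adjudication; programme-internal (2001/route/tribunal) claims are never citable.»

WHY (owner d1-p2-g9 RULINGS ρ-g9-31∕32; this lineage's N-d1leaf03g12-1, journal l.29701).  POWER COUNTING of one term on the shell `‖w‖∞ = s`:
weight `≤ Cp(s+1)^m`; FAR (`s ≥ n`): both legs in far form `B e^{−(δ/n)s}/(s+1)^{p}` ⇒ `≤ E e^{−(δ/n)s}/(s+1)⁴` iff `m + 4 ≤ p₁ + p₂`; WINDOW (`s ≤ n`),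
legs split free + flat (`|F| ≤ A/(s+1)^q`, `|Φ| ≤ D/n^p`): (free,free) `≤ C/s⁵` iff `m + 5 ≤ q₁ + q₂`; (free,flat) `≤ C/(s³n)` iff `m + 4 ≤ q₁ + p₂`
(exponent bookkeeping `s^{m+3}·n ≤ s^q·n^p`, `s ≤ n`); (flat,flat) iff `m + 4 ≤ p₁ + p₂`.  With `p = 2 + min(k,1)`, `q = 2 + min(k,3)` (k = number of
unit differences on the leg) all four are ADMISSIBILITY `m ≤ min(k₁,1) + min(k₂,1)`, `m + 1 ≤ k₁ + k₂` (part (C2) `ScaleLegTermBound`).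
* §1 [folklore] `pow_mul_le_pow_mul_pow` (ℕ, and over ℝ), **`abs_fullSum_le_of_window_quintic_tail`** (THE COUNT), `tendsto_psum_of_tail`.
* §2 [folklore] `abs_shift_neg_le_soft`, **`abs_weighted_far_le`** (tail form), **`abs_weighted_window_le`** (window form: the four products).
Unit `b2b-balaban-beta-d1-formalise-leaf-03` (gen 12), D1 formalisation swarm; `LEAVES-BFx.md` row «A3.c ∕ L-X TAILS» part (C1).
-/

noncomputable section

namespace Summit.QuantumFields.BalabanUV.Beta.D1BFx.ScaleLegTermCount

open Finset Filter Topology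
open scoped BigOperators
open Literature.Probability.LatticeModels (annulus)
open Literature.MathematicalPhysics.QuantumFieldTheory.Balaban1983to89
open Literature.MathematicalPhysics.QuantumFieldTheory.Balaban1983to89.Beta
open DyadicShell (Pt supNorm supNorm_eq_zero_iff sum_Ico_shellSum supNorm_eq_of_mem_sphere)
open WindowLog (shellSum)
open TransferUV (card_annulus_succ_four_le sum_inv_pow_le_two)
open WindowIdentification (psum fullSum abs_fullSum_sub_psum_le exists_tendsto_psum_of_shellBound)
open GradedBubbles (supNorm_neg)
open ScaleLegRows (abs_shift_le_soft inv_pow_transport)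

/-! ## §1 Exponent bookkeeping and THE COUNT -/

/-- [folklore] `s^{m+3}·n ≤ s^q·n^p` in `ℕ` for `1 ≤ s ≤ n`, `1 ≤ p`, `m + 4 ≤ q + p` (trade surplus powers of `s` for powers of `n`). -/
theorem pow_mul_le_pow_mul_pow {s n m q p : ℕ} (hs : 1 ≤ s) (hsn : s ≤ n) (hp : 1 ≤ p) (h : m + 4 ≤ q + p) : s ^ (m + 3) * n ≤ s ^ q * n ^ p := by
  have hn : 1 ≤ n := le_trans hs hsn
  by_cases hq : m + 3 ≤ q
  · calc s ^ (m + 3) * n ≤ s ^ q * n := Nat.mul_le_mul_right _ (Nat.pow_le_pow_right hs hq)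
      _ ≤ s ^ q * n ^ p := Nat.mul_le_mul_left _ (by simpa using Nat.pow_le_pow_right hn hp)
  · have hq' : q ≤ m + 3 := by omega
    have e : s ^ (m + 3) = s ^ q * s ^ (m + 3 - q) := by rw [← pow_add]; congr 1; omega
    rw [e, mul_assoc]
    apply Nat.mul_le_mul_left
    calc s ^ (m + 3 - q) * n ≤ n ^ (m + 3 - q) * n := Nat.mul_le_mul_right _ (Nat.pow_le_pow_left hsn _)
      _ = n ^ (m + 4 - q) := by rw [← pow_succ]; congr 1; omega
      _ ≤ n ^ p := Nat.pow_le_pow_right hn (by omega)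

/-- [folklore] The same over `ℝ`. -/
theorem pow_mul_le_pow_mul_pow_real {s n m q p : ℕ} (hs : 1 ≤ s) (hsn : s ≤ n) (hp : 1 ≤ p) (h : m + 4 ≤ q + p) :
    (s : ℝ) ^ (m + 3) * (n : ℝ) ≤ (s : ℝ) ^ q * (n : ℝ) ^ p := by
  exact_mod_cast pow_mul_le_pow_mul_pow hs hsn hp h

/-- [folklore] **THE COUNT.**  Window shells `r + 1 ≤ n`: `|K w| ≤ C₁/((r+1)³n) + C₂/(r+1)⁵`; tail shells `r ≥ n − 1`:
`|K w| ≤ E e^{−(δ/n)(r+1)}/(r+1)⁴`; then `|fullSum K| ≤ 80C₁ + 160C₂ + 80E(1 + 1/δ)` — INDEPENDENT OF `n` (`#shell ≤ 80(r+1)³`,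
`Σ 1/(r+1)² ≤ 2`, `WindowIdentification.abs_fullSum_sub_psum_le` at `M := n − 1`, `Lr := n`). -/
theorem abs_fullSum_le_of_window_quintic_tail {K : Pt → ℝ} {n : ℕ} (hn : 1 ≤ n) {C₁ C₂ E δ : ℝ} (hC₁ : 0 ≤ C₁) (hC₂ : 0 ≤ C₂) (hE : 0 ≤ E)
    (hδ : 0 < δ)
    (hwin : ∀ r : ℕ, r + 1 ≤ n → ∀ w ∈ annulus 4 r (r + 1), |K w| ≤ C₁ / (((r : ℝ) + 1) ^ 3 * (n : ℝ)) + C₂ / ((r : ℝ) + 1) ^ 5)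
    (htail : ∀ r : ℕ, n - 1 ≤ r → ∀ w ∈ annulus 4 r (r + 1), |K w| ≤ E / ((r : ℝ) + 1) ^ 4 * Real.exp (-(δ / (n : ℝ)) * ((r : ℝ) + 1))) :
    |fullSum K| ≤ 80 * C₁ + 160 * C₂ + 80 * E * (1 + 1 / δ) := by
  have hn0 : (0 : ℝ) < (n : ℝ) := by exact_mod_cast hn
  -- the window
  have hshell : ∀ r : ℕ, r + 1 ≤ n → |shellSum K r| ≤ 80 * C₁ / (n : ℝ) + 80 * C₂ * (1 / ((r : ℝ) + 1) ^ 2) := by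
    intro r hr
    have hr0 : (0 : ℝ) < (r : ℝ) + 1 := by positivity
    rw [shellSum]
    calc |∑ w ∈ annulus 4 r (r + 1), K w| ≤ ∑ w ∈ annulus 4 r (r + 1), |K w| := abs_sum_le_sum_abs _ _
      _ ≤ ∑ w ∈ annulus 4 r (r + 1), (C₁ / (((r : ℝ) + 1) ^ 3 * (n : ℝ)) + C₂ / ((r : ℝ) + 1) ^ 5) := sum_le_sum fun w hw => hwin r hr w hw
      _ = ((annulus 4 r (r + 1)).card : ℝ) * (C₁ / (((r : ℝ) + 1) ^ 3 * (n : ℝ)) + C₂ / ((r : ℝ) + 1) ^ 5) := by rw [sum_const, nsmul_eq_mul]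
      _ ≤ 80 * ((r : ℝ) + 1) ^ 3 * (C₁ / (((r : ℝ) + 1) ^ 3 * (n : ℝ)) + C₂ / ((r : ℝ) + 1) ^ 5) :=
          mul_le_mul_of_nonneg_right (card_annulus_succ_four_le r) (by positivity)
      _ = 80 * C₁ / (n : ℝ) + 80 * C₂ * (1 / ((r : ℝ) + 1) ^ 2) := by field_simp
  have hwindow : |psum K (n - 1)| ≤ 80 * C₁ + 160 * C₂ := by
    rw [psum, ← sum_Ico_shellSum K (Nat.zero_le (n - 1))]
    calc |∑ r ∈ Ico 0 (n - 1), shellSum K r| ≤ ∑ r ∈ Ico 0 (n - 1), |shellSum K r| := abs_sum_le_sum_abs _ _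
      _ ≤ ∑ r ∈ Ico 0 (n - 1), (80 * C₁ / (n : ℝ) + 80 * C₂ * (1 / ((r : ℝ) + 1) ^ 2)) := by
          refine sum_le_sum fun r hr => hshell r ?_
          have := (mem_Ico.mp hr).2
          omega
      _ = ((n - 1 : ℕ) : ℝ) * (80 * C₁ / (n : ℝ)) + 80 * C₂ * ∑ r ∈ Finset.range (n - 1), 1 / ((r : ℝ) + 1) ^ 2 := by
          rw [sum_add_distrib, sum_const, Nat.card_Ico, Nat.sub_zero, nsmul_eq_mul, ← mul_sum, Finset.range_eq_Ico]
      _ ≤ (n : ℝ) * (80 * C₁ / (n : ℝ)) + 80 * C₂ * 2 := by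
          gcongr
          · exact_mod_cast Nat.sub_le n 1
          · exact sum_inv_pow_le_two le_rfl _
      _ = 80 * C₁ + 160 * C₂ := by field_simp; ring
  -- the tail
  have htail' := abs_fullSum_sub_psum_le (K := K) (M := n - 1) hE hδ hn0 htail le_rfl
  have hM : (((n - 1 : ℕ) : ℝ) + 1) = (n : ℝ) := by rw [Nat.cast_sub hn, Nat.cast_one]; ring
  rw [hM] at htail'
  have htail'' : |fullSum K - psum K (n - 1)| ≤ 80 * E * (1 + 1 / δ) := by
    refine htail'.trans ?_
    rw [div_le_iff₀ hn0]
    have h1 : (1 : ℝ) ≤ n := by exact_mod_cast hn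
    have h2 : 80 * E ≤ 80 * E * (n : ℝ) := le_mul_of_one_le_right (by positivity) h1
    have h3 : 80 * E * (1 + (n : ℝ) / δ) = 80 * E + 80 * E / δ * n := by ring
    have h4 : 80 * E * (1 + 1 / δ) * (n : ℝ) = 80 * E * n + 80 * E / δ * n := by ring
    rw [h3, h4]
    linarith
  calc |fullSum K| = |(fullSum K - psum K (n - 1)) + psum K (n - 1)| := by rw [sub_add_cancel]
    _ ≤ |fullSum K - psum K (n - 1)| + |psum K (n - 1)| := abs_add_le _ _
    _ ≤ 80 * E * (1 + 1 / δ) + (80 * C₁ + 160 * C₂) := add_le_add htail'' hwindow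
    _ = 80 * C₁ + 160 * C₂ + 80 * E * (1 + 1 / δ) := by ring

/-- [folklore] The tail alone makes the punctured partial sums converge. -/
theorem tendsto_psum_of_tail {K : Pt → ℝ} {n : ℕ} (hn : 1 ≤ n) {E δ : ℝ} (hE : 0 ≤ E) (hδ : 0 < δ)
    (htail : ∀ r : ℕ, n - 1 ≤ r → ∀ w ∈ annulus 4 r (r + 1), |K w| ≤ E / ((r : ℝ) + 1) ^ 4 * Real.exp (-(δ / (n : ℝ)) * ((r : ℝ) + 1))) :
    ∃ B : ℝ, Tendsto (psum K) atTop (𝓝 B) :=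
  exists_tendsto_psum_of_shellBound (M := n - 1) hE hδ (by exact_mod_cast hn : (0 : ℝ) < n) htail

/-! ## §2 Abstract per-point bounds for a weighted located product `P(w)·c·H₁(x − w)·H₂(w + y)` -/

section PerPoint

variable {n : ℕ} {δ Cp c : ℝ} {m : ℕ} {P H₁ H₂ : Pt → ℝ} {x y : Pt}

/-- [folklore] The moment weight through a reflected argument: `‖−w‖∞ = ‖w‖∞` in the soft-transport shape. -/
theorem abs_shift_neg_le_soft (hn : 1 ≤ n) (hδ : 0 ≤ δ) {B : ℝ} (hB : 0 ≤ B) {p : ℕ} {ψ : Pt → ℝ}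
    (h : ∀ u : Pt, |ψ u| ≤ B * Real.exp (-(δ / n) * supNorm u) / ((supNorm u : ℝ) + 1) ^ p) (x w : Pt) :
    |ψ (x - w)| ≤ B * (Real.exp (δ * supNorm x) * ((supNorm x : ℝ) + 1) ^ p) * Real.exp (-(δ / n) * supNorm w) / ((supNorm w : ℝ) + 1) ^ p := by
  have h1 := abs_shift_le_soft hn hδ hB h (-w) x
  rwa [supNorm_neg, show -w + x = x - w by abel] at h1

/-- [folklore] **THE TAIL FORM.**  Weight `|P w| ≤ Cp(‖w‖∞+1)^m`, legs in far form with exponents `p₁, p₂`, `m + 4 ≤ p₁ + p₂` ⇒ for ALL `w`,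
`|P w·c·H₁(x−w)·H₂(w+y)| ≤ [Cp|c|B₁B₂e^{δ‖x‖∞}(‖x‖∞+1)^{p₁}e^{δ‖y‖∞}(‖y‖∞+1)^{p₂}]·e^{−(δ/n)‖w‖∞}/(‖w‖∞+1)⁴`. -/
theorem abs_weighted_far_le (hn : 1 ≤ n) (hδ : 0 ≤ δ) (hCp : 0 ≤ Cp) (hP : ∀ w : Pt, |P w| ≤ Cp * ((supNorm w : ℝ) + 1) ^ m)
    {B₁ B₂ : ℝ} (hB₁ : 0 ≤ B₁) (hB₂ : 0 ≤ B₂) {p₁ p₂ : ℕ}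
    (h₁ : ∀ u : Pt, |H₁ u| ≤ B₁ * Real.exp (-(δ / n) * supNorm u) / ((supNorm u : ℝ) + 1) ^ p₁)
    (h₂ : ∀ u : Pt, |H₂ u| ≤ B₂ * Real.exp (-(δ / n) * supNorm u) / ((supNorm u : ℝ) + 1) ^ p₂) (hm : m + 4 ≤ p₁ + p₂) (w : Pt) :
    |P w * (c * (H₁ (x - w) * H₂ (w + y)))| ≤
      Cp * |c| * (B₁ * (Real.exp (δ * supNorm x) * ((supNorm x : ℝ) + 1) ^ p₁)) * (B₂ * (Real.exp (δ * supNorm y) * ((supNorm y : ℝ) + 1) ^ p₂)) *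
        Real.exp (-(δ / n) * supNorm w) / ((supNorm w : ℝ) + 1) ^ 4 := by
  set s : ℝ := (supNorm w : ℝ) with hs
  set Ew : ℝ := Real.exp (-(δ / n) * s) with hEw
  have hs0 : 0 ≤ s := Nat.cast_nonneg _
  have hEw0 : 0 < Ew := Real.exp_pos _
  have hEw1 : Ew ≤ 1 := Real.exp_le_one_iff.mpr (by
    have : 0 ≤ δ / n := div_nonneg hδ (Nat.cast_nonneg _)
    nlinarith)
  set K₁ : ℝ := B₁ * (Real.exp (δ * supNorm x) * ((supNorm x : ℝ) + 1) ^ p₁) with hK₁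
  set K₂ : ℝ := B₂ * (Real.exp (δ * supNorm y) * ((supNorm y : ℝ) + 1) ^ p₂) with hK₂
  have hK₁0 : 0 ≤ K₁ := by positivity
  have hK₂0 : 0 ≤ K₂ := by positivity
  have g₁ : |H₁ (x - w)| ≤ K₁ * Ew / (s + 1) ^ p₁ := abs_shift_neg_le_soft hn hδ hB₁ h₁ x w
  have g₂ : |H₂ (w + y)| ≤ K₂ * Ew / (s + 1) ^ p₂ := abs_shift_le_soft hn hδ hB₂ h₂ w y
  have gP := hP w
  rw [abs_mul, abs_mul, abs_mul]
  have hpow : (s + 1) ^ (m + 4) ≤ (s + 1) ^ (p₁ + p₂) := pow_le_pow_right₀ (by linarith) hm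
  have hsp : 0 < (s + 1) ^ p₁ := by positivity
  have hsp' : 0 < (s + 1) ^ p₂ := by positivity
  calc |P w| * (|c| * (|H₁ (x - w)| * |H₂ (w + y)|))
      ≤ (Cp * (s + 1) ^ m) * (|c| * ((K₁ * Ew / (s + 1) ^ p₁) * (K₂ * Ew / (s + 1) ^ p₂))) := by
        gcongr
    _ = Cp * |c| * K₁ * K₂ * Ew * (Ew * ((s + 1) ^ m / ((s + 1) ^ p₁ * (s + 1) ^ p₂))) := by
        field_simp
    _ ≤ Cp * |c| * K₁ * K₂ * Ew * (1 * (1 / (s + 1) ^ 4)) := by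
        apply mul_le_mul_of_nonneg_left _ (by positivity)
        apply mul_le_mul hEw1 _ (by positivity) zero_le_one
        rw [div_le_div_iff₀ (by positivity) (by positivity), one_mul, ← pow_add, ← pow_add]
        exact hpow
    _ = Cp * |c| * K₁ * K₂ * Ew / (s + 1) ^ 4 := by ring

/-- [folklore] **THE WINDOW FORM.**  On the shell `‖w‖∞ = r + 1 ≤ n`: weight `≤ Cp(‖w‖∞+1)^m`, legs SPLIT `H_i = F_i + Φ_i` with `|F_i u| ≤ A_i/(‖u‖∞+1)^{q_i}`
(free part) and `|Φ_i u| ≤ D_i/n^{p_i}` (flat part), exponents with `m + 5 ≤ q₁ + q₂`, `m + 4 ≤ q₁ + p₂`, `m + 4 ≤ p₁ + q₂`, `m + 4 ≤ p₁ + p₂`,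
`1 ≤ p₁`, `1 ≤ p₂` ⇒ `|P w·c·H₁(x−w)·H₂(w+y)| ≤ C₁/((r+1)³n) + C₂/(r+1)⁵` with the n-free
`C₁ = Cp|c|2^m(A₁'D₂ + D₁A₂' + D₁D₂)`, `C₂ = Cp|c|2^m A₁'A₂'`, `A₁' = A₁(‖x‖∞+1)^{q₁}`, `A₂' = A₂(‖y‖∞+1)^{q₂}`. -/
theorem abs_weighted_window_le (hn : 1 ≤ n) (hCp : 0 ≤ Cp) (hP : ∀ w : Pt, |P w| ≤ Cp * ((supNorm w : ℝ) + 1) ^ m)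
    {F₁ Φ₁ F₂ Φ₂ : Pt → ℝ} (hH₁ : ∀ u, H₁ u = F₁ u + Φ₁ u) (hH₂ : ∀ u, H₂ u = F₂ u + Φ₂ u)
    {A₁ A₂ D₁ D₂ : ℝ} (hA₁ : 0 ≤ A₁) (hA₂ : 0 ≤ A₂) (hD₁ : 0 ≤ D₁) (hD₂ : 0 ≤ D₂) {q₁ q₂ p₁ p₂ : ℕ}
    (hF₁ : ∀ u : Pt, |F₁ u| ≤ A₁ / ((supNorm u : ℝ) + 1) ^ q₁) (hF₂ : ∀ u : Pt, |F₂ u| ≤ A₂ / ((supNorm u : ℝ) + 1) ^ q₂)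
    (hΦ₁ : ∀ u : Pt, |Φ₁ u| ≤ D₁ / (n : ℝ) ^ p₁) (hΦ₂ : ∀ u : Pt, |Φ₂ u| ≤ D₂ / (n : ℝ) ^ p₂)
    (hqq : m + 5 ≤ q₁ + q₂) (hqp : m + 4 ≤ q₁ + p₂) (hpq : m + 4 ≤ p₁ + q₂) (hpp : m + 4 ≤ p₁ + p₂) (hp₁ : 1 ≤ p₁) (hp₂ : 1 ≤ p₂)
    {r : ℕ} (hr : r + 1 ≤ n) {w : Pt} (hw : w ∈ annulus 4 r (r + 1)) :
    |P w * (c * (H₁ (x - w) * H₂ (w + y)))| ≤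
      Cp * |c| * 2 ^ m * (A₁ * ((supNorm x : ℝ) + 1) ^ q₁ * D₂ + D₁ * (A₂ * ((supNorm y : ℝ) + 1) ^ q₂) + D₁ * D₂) / (((r : ℝ) + 1) ^ 3 * (n : ℝ))
      + Cp * |c| * 2 ^ m * (A₁ * ((supNorm x : ℝ) + 1) ^ q₁ * (A₂ * ((supNorm y : ℝ) + 1) ^ q₂)) / ((r : ℝ) + 1) ^ 5 := by
  -- the shell radius
  have hsw : supNorm w = r + 1 := supNorm_eq_of_mem_sphere hw
  set s : ℝ := (supNorm w : ℝ) with hs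
  have hs1 : s = (r : ℝ) + 1 := by rw [hs, hsw]; push_cast; ring
  have hs1' : (1 : ℝ) ≤ s := by rw [hs1]; have : (0:ℝ) ≤ r := Nat.cast_nonneg _; linarith
  have hsn : s ≤ n := by rw [hs1]; exact_mod_cast hr
  have hn0 : (0 : ℝ) < n := by exact_mod_cast hn
  set A₁' : ℝ := A₁ * ((supNorm x : ℝ) + 1) ^ q₁ with hA₁'
  set A₂' : ℝ := A₂ * ((supNorm y : ℝ) + 1) ^ q₂ with hA₂'
  have hA₁'0 : 0 ≤ A₁' := by positivity
  have hA₂'0 : 0 ≤ A₂' := by positivity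
  -- transported free-leg bounds at the two arguments
  have f₁ : |F₁ (x - w)| ≤ A₁' / (s + 1) ^ q₁ := by
    refine (hF₁ (x - w)).trans ?_
    have h := inv_pow_transport (-w) x q₁
    rw [supNorm_neg, show -w + x = x - w by abel] at h
    calc A₁ / ((supNorm (x - w) : ℝ) + 1) ^ q₁ = A₁ * (1 / ((supNorm (x - w) : ℝ) + 1) ^ q₁) := by ring
      _ ≤ A₁ * (((supNorm x : ℝ) + 1) ^ q₁ / (s + 1) ^ q₁) := mul_le_mul_of_nonneg_left h hA₁
      _ = A₁' / (s + 1) ^ q₁ := by rw [hA₁']; ring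
  have f₂ : |F₂ (w + y)| ≤ A₂' / (s + 1) ^ q₂ := by
    refine (hF₂ (w + y)).trans ?_
    have h := inv_pow_transport w y q₂
    calc A₂ / ((supNorm (w + y) : ℝ) + 1) ^ q₂ = A₂ * (1 / ((supNorm (w + y) : ℝ) + 1) ^ q₂) := by ring
      _ ≤ A₂ * (((supNorm y : ℝ) + 1) ^ q₂ / (s + 1) ^ q₂) := mul_le_mul_of_nonneg_left h hA₂
      _ = A₂' / (s + 1) ^ q₂ := by rw [hA₂']; ring
  have φ₁ := hΦ₁ (x - w)
  have φ₂ := hΦ₂ (w + y)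
  -- weight: `(s+1)^m ≤ 2^m s^m`
  have gP : |P w| ≤ Cp * 2 ^ m * s ^ m := by
    refine (hP w).trans ?_
    rw [mul_assoc, ← mul_pow]
    exact mul_le_mul_of_nonneg_left (pow_le_pow_left₀ (by linarith) (by linarith) m) hCp
  -- denominators `(s+1)^q ≥ s^q`
  have den : ∀ q : ℕ, ∀ {A : ℝ}, 0 ≤ A → A / (s + 1) ^ q ≤ A / s ^ q := fun q A hA =>
    div_le_div_of_nonneg_left hA (by positivity) (pow_le_pow_left₀ (by linarith) (by linarith) q)
  have f₁' : |F₁ (x - w)| ≤ A₁' / s ^ q₁ := f₁.trans (den q₁ hA₁'0)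
  have f₂' : |F₂ (w + y)| ≤ A₂' / s ^ q₂ := f₂.trans (den q₂ hA₂'0)
  -- the four products, each against its target by the exponent bookkeeping
  have hsR : (1 : ℕ) ≤ r + 1 := by omega
  have key : ∀ {q p : ℕ}, 1 ≤ p → m + 4 ≤ q + p → s ^ m / (s ^ q * (n : ℝ) ^ p) ≤ 1 / (s ^ 3 * (n : ℝ)) := by
    intro q p hp h
    have hk := pow_mul_le_pow_mul_pow_real (s := r + 1) (n := n) (m := m) hsR hr hp h
    push_cast at hk
    rw [← hs1] at hk
    rw [div_le_div_iff₀ (by positivity) (by positivity), one_mul]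
    calc s ^ m * (s ^ 3 * (n : ℝ)) = s ^ (m + 3) * n := by ring
      _ ≤ s ^ q * (n : ℝ) ^ p := hk
  have keyFF : s ^ m / (s ^ q₁ * s ^ q₂) ≤ 1 / s ^ 5 := by
    rw [div_le_div_iff₀ (by positivity) (by positivity), one_mul, ← pow_add, ← pow_add]
    exact pow_le_pow_right₀ hs1' hqq
  -- expand the product
  rw [hH₁, hH₂]
  have e : P w * (c * ((F₁ (x - w) + Φ₁ (x - w)) * (F₂ (w + y) + Φ₂ (w + y)))) =
      P w * c * (F₁ (x - w) * Φ₂ (w + y)) + P w * c * (Φ₁ (x - w) * F₂ (w + y)) + P w * c * (Φ₁ (x - w) * Φ₂ (w + y))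
      + P w * c * (F₁ (x - w) * F₂ (w + y)) := by ring
  rw [e]
  have T1 : |P w * c * (F₁ (x - w) * Φ₂ (w + y))| ≤ Cp * |c| * 2 ^ m * (A₁' * D₂) / (s ^ 3 * (n : ℝ)) := by
    rw [abs_mul, abs_mul, abs_mul]
    calc |P w| * |c| * (|F₁ (x - w)| * |Φ₂ (w + y)|) ≤ (Cp * 2 ^ m * s ^ m) * |c| * ((A₁' / s ^ q₁) * (D₂ / (n : ℝ) ^ p₂)) := by gcongr
      _ = Cp * |c| * 2 ^ m * (A₁' * D₂) * (s ^ m / (s ^ q₁ * (n : ℝ) ^ p₂)) := by field_simp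
      _ ≤ Cp * |c| * 2 ^ m * (A₁' * D₂) * (1 / (s ^ 3 * (n : ℝ))) := mul_le_mul_of_nonneg_left (key hp₂ hqp) (by positivity)
      _ = _ := by ring
  have T2 : |P w * c * (Φ₁ (x - w) * F₂ (w + y))| ≤ Cp * |c| * 2 ^ m * (D₁ * A₂') / (s ^ 3 * (n : ℝ)) := by
    rw [abs_mul, abs_mul, abs_mul]
    calc |P w| * |c| * (|Φ₁ (x - w)| * |F₂ (w + y)|) ≤ (Cp * 2 ^ m * s ^ m) * |c| * ((D₁ / (n : ℝ) ^ p₁) * (A₂' / s ^ q₂)) := by gcongr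
      _ = Cp * |c| * 2 ^ m * (D₁ * A₂') * (s ^ m / (s ^ q₂ * (n : ℝ) ^ p₁)) := by field_simp
      _ ≤ Cp * |c| * 2 ^ m * (D₁ * A₂') * (1 / (s ^ 3 * (n : ℝ))) :=
          mul_le_mul_of_nonneg_left (key hp₁ (by omega)) (by positivity)
      _ = _ := by ring
  have T3 : |P w * c * (Φ₁ (x - w) * Φ₂ (w + y))| ≤ Cp * |c| * 2 ^ m * (D₁ * D₂) / (s ^ 3 * (n : ℝ)) := by
    rw [abs_mul, abs_mul, abs_mul]
    calc |P w| * |c| * (|Φ₁ (x - w)| * |Φ₂ (w + y)|) ≤ (Cp * 2 ^ m * s ^ m) * |c| * ((D₁ / (n : ℝ) ^ p₁) * (D₂ / (n : ℝ) ^ p₂)) := by gcongr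
      _ = Cp * |c| * 2 ^ m * (D₁ * D₂) * (s ^ m / (s ^ 0 * (n : ℝ) ^ (p₁ + p₂))) := by rw [pow_zero, one_mul, pow_add]; field_simp
      _ ≤ Cp * |c| * 2 ^ m * (D₁ * D₂) * (1 / (s ^ 3 * (n : ℝ))) :=
          mul_le_mul_of_nonneg_left (key (by omega) (by omega)) (by positivity)
      _ = _ := by ring
  have T4 : |P w * c * (F₁ (x - w) * F₂ (w + y))| ≤ Cp * |c| * 2 ^ m * (A₁' * A₂') / s ^ 5 := by
    rw [abs_mul, abs_mul, abs_mul]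
    calc |P w| * |c| * (|F₁ (x - w)| * |F₂ (w + y)|) ≤ (Cp * 2 ^ m * s ^ m) * |c| * ((A₁' / s ^ q₁) * (A₂' / s ^ q₂)) := by gcongr
      _ = Cp * |c| * 2 ^ m * (A₁' * A₂') * (s ^ m / (s ^ q₁ * s ^ q₂)) := by field_simp
      _ ≤ Cp * |c| * 2 ^ m * (A₁' * A₂') * (1 / s ^ 5) := mul_le_mul_of_nonneg_left keyFF (by positivity)
      _ = _ := by ring
  rw [← hs1]
  calc |P w * c * (F₁ (x - w) * Φ₂ (w + y)) + P w * c * (Φ₁ (x - w) * F₂ (w + y)) + P w * c * (Φ₁ (x - w) * Φ₂ (w + y))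
        + P w * c * (F₁ (x - w) * F₂ (w + y))|
      ≤ |P w * c * (F₁ (x - w) * Φ₂ (w + y))| + |P w * c * (Φ₁ (x - w) * F₂ (w + y))| + |P w * c * (Φ₁ (x - w) * Φ₂ (w + y))|
        + |P w * c * (F₁ (x - w) * F₂ (w + y))| := by
        refine (abs_add_le _ _).trans (add_le_add ((abs_add_le _ _).trans (add_le_add (abs_add_le _ _) le_rfl)) le_rfl)
    _ ≤ Cp * |c| * 2 ^ m * (A₁' * D₂) / (s ^ 3 * (n : ℝ)) + Cp * |c| * 2 ^ m * (D₁ * A₂') / (s ^ 3 * (n : ℝ))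
        + Cp * |c| * 2 ^ m * (D₁ * D₂) / (s ^ 3 * (n : ℝ)) + Cp * |c| * 2 ^ m * (A₁' * A₂') / s ^ 5 :=
        add_le_add (add_le_add (add_le_add T1 T2) T3) T4
    _ = _ := by ring

end PerPoint

end Summit.QuantumFields.BalabanUV.Beta.D1BFx.ScaleLegTermCount

end
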